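import Summits.Ventures.PercRepro.RankLevelSetThroughMinorPair

/-! # RankLevelSetThroughMinorSix — THE EXACT RESIDUE OF (★★) AT LEVEL `6`: (↑)₅ AND THE PAIR (↑)₅ ON THE
MINORS OF NULLITY `≤ 5` (night-1 g40; dossier §52.10–52.11; on `RankLevelSetThroughMinorPair`)

In the per-circuit decomposition of (★★) at level `6` at an element `y` in no parallel pair of a coloop-free
matroid (`13 < #E`), a circuit class with `≥ 5` elements closes under the chain (`perCircuit_le`, `#K + 1 ≥ 6`), a
4-circuit class is the pair (↑) at level `5` on the minor `M ／ y ＼ a` (`perCircuit_four_iff_upPairAt`) and a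
triangle class is (↑) at level `5` on the minor (`perCircuit_triangle_iff_upAt`) —
**`perElemAt_six_of_coloopFree_of_upAt`**. The minor has `#E − 2 ≥ 12` elements and nullity `≤ rk M✶ − 1 ≤ 5`
(`eRank_dual_contract_delete_add_one_le`, `absorb_dual_facts`), so **`perElemAt_six_of_coloopFree_of_up_nullity`**:
(★★) at level `6` on every coloop-free matroid at an element in no parallel pair follows from (↑) at level `5` and
the pair (↑) at level `5` at every element / pair of every matroid of nullity `≤ 5` with `≥ 12` elements — the exact
residue of level `6`. Every declaration has a docstring; imports: the cell's own modules and Mathlib only.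
Axioms: standard. -/

namespace PercRepro

open Set Matroid

variable {α : Type} (M : Matroid α) [M.Finite]

/-- **(★★) AT LEVEL `6` ON A COLOOP-FREE MATROID AT AN ELEMENT IN NO PARALLEL PAIR, FROM (↑)₅ AND THE PAIR (↑)₅ ON
THE MINORS `M ／ y ＼ a` OF ITS TRIANGLES AND 4-CIRCUITS** (`13 < #E`): the circuits with `≥ 5` elements close under
the chain (`perCircuit_le`), a 4-circuit class is the pair (↑) on the minor, a triangle class is (↑) on the minor. -/
theorem perElemAt_six_of_coloopFree_of_upAt (hcol : ∀ e, ¬ M.IsColoop e) {y : α} (hy : y ∈ M.E)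
    (hnp : ∀ z, z ≠ y → y ∉ M.closure {z}) (hn : 2 * 6 + 1 < M.E.ncard)
    (hup : ∀ a b, M.IsCircuit {y, a, b} → y ≠ a → y ≠ b → a ≠ b → M✶.eRank ≤ 6 →
      BiIndepUpAt ((M.contract {y}).delete {a}) b 5)
    (hpair : ∀ a b c, M.IsCircuit {y, a, b, c} → y ≠ a → y ≠ b → y ≠ c → a ≠ b → a ≠ c → b ≠ c →
      M✶.eRank ≤ 6 → BiIndepUpPairAt ((M.contract {y}).delete {a}) b c 5) :
    {Z ∈ biIndep M 6 | y ∉ Z}.ncard ≤ {Q ∈ biIndep M 7 | y ∈ Q}.ncard := by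
  obtain ⟨z₀, hz₀⟩ : (M.E \ {y}).Nonempty := by
    rw [← Set.ncard_pos (M.ground_finite.subset Set.sdiff_subset), Set.ncard_sdiff_singleton_of_mem hy]
    omega
  have hz₀y : z₀ ≠ y := by simpa using hz₀.2
  refine perElemAt_of_perCircuit M hy 6 ?_
  intro Z₀ hZ₀
  have h3 := (fundCircuit_ncard_absorb M hy hnp hz₀y hZ₀).1
  rcases Nat.lt_or_ge 4 (M.fundCircuit y Z₀).ncard with h5 | h4'
  · exact perCircuit_le M hcol hy (by norm_num) hn hZ₀ (by omega)
  have hycl := mem_closure_of_mem_lowAbsorbAt' M hy hZ₀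
  obtain ⟨-, -, -, -, -, hrank⟩ := absorb_dual_facts M hy hZ₀
  obtain ⟨⟨-, -, hZi, -⟩, hyZ, -⟩ := hZ₀
  have hC : M.IsCircuit (M.fundCircuit y Z₀) := hZi.fundCircuit_isCircuit hycl hyZ
  have hyK : y ∈ M.fundCircuit y Z₀ := M.mem_fundCircuit y Z₀
  rcases Nat.lt_or_ge 3 (M.fundCircuit y Z₀).ncard with h4 | h3'
  · -- the circuit is a 4-circuit `{y, a, b, c}`
    have hKcard : (M.fundCircuit y Z₀).ncard = 4 := by omega
    have h3c : ((M.fundCircuit y Z₀) \ {y}).ncard = 3 := by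
      rw [Set.ncard_sdiff_singleton_of_mem hyK, hKcard]
    obtain ⟨a, b, c, hab, hac, hbc, hS⟩ := Set.ncard_eq_three.mp h3c
    have hKeq : M.fundCircuit y Z₀ = {y, a, b, c} := by
      rw [← Set.insert_sdiff_self_of_mem hyK, hS]
    have hya : y ≠ a := by
      intro h
      have : a ∈ (M.fundCircuit y Z₀) \ {y} := hS ▸ (by simp)
      exact this.2 (by simp [h])
    have hyb : y ≠ b := by
      intro h
      have : b ∈ (M.fundCircuit y Z₀) \ {y} := hS ▸ (by simp)
      exact this.2 (by simp [h])
    have hyc : y ≠ c := by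
      intro h
      have : c ∈ (M.fundCircuit y Z₀) \ {y} := hS ▸ (by simp)
      exact this.2 (by simp [h])
    rw [hKeq] at hC ⊢
    exact (perCircuit_four_iff_upPairAt M hC hya hyb hyc hab hac (by norm_num) hn).mpr
      (hpair a b c hC hya hyb hyc hab hac hbc hrank)
  · -- the circuit is a triangle `{y, a, b}`
    have hKcard : (M.fundCircuit y Z₀).ncard = 3 := by omega
    have h2 : ((M.fundCircuit y Z₀) \ {y}).ncard = 2 := by
      rw [Set.ncard_sdiff_singleton_of_mem hyK, hKcard]
    obtain ⟨a, b, hab, hS⟩ := Set.ncard_eq_two.mp h2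
    have hKeq : M.fundCircuit y Z₀ = {y, a, b} := by
      rw [← Set.insert_sdiff_self_of_mem hyK, hS]
    have hya : y ≠ a := by
      intro h
      have : a ∈ (M.fundCircuit y Z₀) \ {y} := hS ▸ (by simp)
      exact this.2 (by simp [h])
    have hyb : y ≠ b := by
      intro h
      have : b ∈ (M.fundCircuit y Z₀) \ {y} := hS ▸ (by simp)
      exact this.2 (by simp [h])
    rw [hKeq] at hC ⊢
    exact (perCircuit_triangle_iff_upAt M hC hya hyb hab (by norm_num) hn).mpr
      (hup a b hC hya hyb hab hrank)

/-- **THE EXACT RESIDUE OF LEVEL `6`: (★★) AT LEVEL `6` ON EVERY COLOOP-FREE MATROID AT AN ELEMENT IN NO PARALLEL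
PAIR FOLLOWS FROM (↑)₅ AND THE PAIR (↑)₅ ON EVERY MATROID OF NULLITY `≤ 5` WITH `≥ 12` ELEMENTS** (`13 < #E`): the
minor `M ／ y ＼ a` of a triangle or a 4-circuit has `#E − 2` elements and nullity `≤ rk M✶ − 1 ≤ 5`. -/
theorem perElemAt_six_of_coloopFree_of_up_nullity (hcol : ∀ e, ¬ M.IsColoop e) {y : α} (hy : y ∈ M.E)
    (hnp : ∀ z, z ≠ y → y ∉ M.closure {z}) (hn : 2 * 6 + 1 < M.E.ncard)
    (hup : ∀ (N : Matroid α) [N.Finite], N✶.eRank ≤ 5 → 12 ≤ N.E.ncard → ∀ b ∈ N.E, BiIndepUpAt N b 5)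
    (hpair : ∀ (N : Matroid α) [N.Finite], N✶.eRank ≤ 5 → 12 ≤ N.E.ncard →
      ∀ b ∈ N.E, ∀ c ∈ N.E, b ≠ c → BiIndepUpPairAt N b c 5) :
    {Z ∈ biIndep M 6 | y ∉ Z}.ncard ≤ {Q ∈ biIndep M 7 | y ∈ Q}.ncard := by
  refine perElemAt_six_of_coloopFree_of_upAt M hcol hy hnp hn ?_ ?_
  · intro a b hK hya hyb hab hrank
    have haE : a ∈ M.E := hK.subset_ground (by simp)
    have hbE : b ∈ M.E := hK.subset_ground (by simp)
    haveI := contract_delete_finite M y a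
    have hbN : b ∈ ((M.contract {y}).delete {a}).E := by
      rw [ground_contract_delete]
      exact ⟨hbE, by simp only [Set.mem_insert_iff, Set.mem_singleton_iff, not_or]; exact ⟨hyb.symm, hab.symm⟩⟩
    have hcard := ncard_ground_contract_delete' M hy haE hya
    have h1 := eRank_dual_contract_delete_add_one_le M hya haE (hcol a)
    have h2 : ((M.contract {y}).delete {a})✶.eRank + 1 ≤ (5 : ℕ∞) + 1 := by
      rw [show (5 : ℕ∞) + 1 = 6 by norm_num]
      exact h1.trans hrank
    have h3 : ((M.contract {y}).delete {a})✶.eRank ≤ 5 := (WithTop.add_le_add_iff_right (by decide)).mp h2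
    exact hup _ h3 (by rw [hcard]; omega) b hbN
  · intro a b c hK hya hyb hyc hab hac hbc hrank
    have haE : a ∈ M.E := hK.subset_ground (by simp)
    have hbE : b ∈ M.E := hK.subset_ground (by simp)
    have hcE : c ∈ M.E := hK.subset_ground (by simp)
    haveI := contract_delete_finite M y a
    have hbN : b ∈ ((M.contract {y}).delete {a}).E := by
      rw [ground_contract_delete]
      exact ⟨hbE, by simp only [Set.mem_insert_iff, Set.mem_singleton_iff, not_or]; exact ⟨hyb.symm, hab.symm⟩⟩
    have hcN : c ∈ ((M.contract {y}).delete {a}).E := by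
      rw [ground_contract_delete]
      exact ⟨hcE, by simp only [Set.mem_insert_iff, Set.mem_singleton_iff, not_or]; exact ⟨hyc.symm, hac.symm⟩⟩
    have hcard := ncard_ground_contract_delete' M hy haE hya
    have h1 := eRank_dual_contract_delete_add_one_le M hya haE (hcol a)
    have h2 : ((M.contract {y}).delete {a})✶.eRank + 1 ≤ (5 : ℕ∞) + 1 := by
      rw [show (5 : ℕ∞) + 1 = 6 by norm_num]
      exact h1.trans hrank
    have h3 : ((M.contract {y}).delete {a})✶.eRank ≤ 5 := (WithTop.add_le_add_iff_right (by decide)).mp h2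
    exact hpair _ h3 (by rw [hcard]; omega) b hbN c hcN hbc

end PercRepro
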